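import Mathlib.Combinatorics.Matroid.Minor.Delete
import Mathlib.Combinatorics.Matroid.Loop
import Mathlib.Combinatorics.Matroid.Closure

/-!
# PercRepro — S2: THE BASES LOWER BOUND `#bases ≥ |E| − r + 1` (p7, gen 11; sub-claim S2; the flat count's first lemma)

A loopless finite matroid on `n` points with bases of size `r` has at least `n − r + 1` bases: if every element is a coloop the
ground set is the unique base (`n = r`); otherwise delete a non-coloop `e` — the bases of `M ＼ {e}` are the bases of `M` avoiding
`e` (**`isBase_delete_singleton_iff`**), some base contains `e` (`e` is a nonloop), and the induction hypothesis on `M ＼ {e}`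
(same rank, one point fewer) gives the count. Stated with any base `B₀` in place of the rank: **`ncard_add_one_le_ncard_isBase_add`**.
Use (S2 v33 §R3⁗(r)(5)(b), the FLAT COUNT of the concentrated case): the number of `(5 − r)`-subsets of `B ∖ W` spanning
`cl(B)` over `B ∩ W` is the number of bases of the loopless rank-`(5 − r)` minor `(M ／ (B ∩ W)) | (B ∖ W)` — at least
`|B ∖ W| − 4 + r` — the division of the `(B, S)` double count. Axioms: standard.
-/

open scoped Matroid

namespace PercRepro

namespace S2

variable {α : Type}

/-- **The bases of `M ＼ {e}` for a non-coloop `e`** are the bases of `M` avoiding `e`. -/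
theorem isBase_delete_singleton_iff (M : Matroid α) {e : α} (he : ¬ M.IsColoop e) {B : Set α} :
    (M ＼ {e}).IsBase B ↔ M.IsBase B ∧ e ∉ B := by
  rw [Matroid.delete_isBase_iff]
  constructor
  · intro h
    have hsp : M.Spanning (M.E \ {e}) := by
      by_contra hns
      exact he (Matroid.isColoop_iff_sdiff_not_spanning.2 hns)
    exact ⟨h.isBase_of_spanning hsp, fun heB => (h.subset heB).2 rfl⟩
  · rintro ⟨hB, heB⟩
    exact hB.isBasis_ground.isBasis_subset
      (Set.subset_sdiff.2 ⟨hB.subset_ground, Set.disjoint_singleton_right.2 heB⟩) Set.sdiff_subset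

/-- **The bases lower bound**: a loopless finite matroid with a base `B₀` has at least `|E| − |B₀| + 1` bases. -/
theorem ncard_add_one_le_ncard_isBase_add (M : Matroid α) [M.Finite]
    (hL : ∀ e ∈ M.E, ¬ M.IsLoop e) {B₀ : Set α} (hB₀ : M.IsBase B₀) :
    M.E.ncard + 1 ≤ {B : Set α | M.IsBase B}.ncard + B₀.ncard := by
  classical
  suffices H : ∀ n : ℕ, ∀ (M : Matroid α) [M.Finite], M.E.ncard = n → (∀ e ∈ M.E, ¬ M.IsLoop e) →
      ∀ B₀ : Set α, M.IsBase B₀ → M.E.ncard + 1 ≤ {B : Set α | M.IsBase B}.ncard + B₀.ncard from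
    H _ M rfl hL B₀ hB₀
  intro n
  induction n using Nat.strong_induction_on with
  | _ n ih =>
  intro M _ hn hL B₀ hB₀
  have hfin : {B : Set α | M.IsBase B}.Finite :=
    M.ground_finite.finite_subsets.subset (fun B hB => hB.subset_ground)
  by_cases hcol : ∃ e ∈ M.E, ¬ M.IsColoop e
  · obtain ⟨e, heE, he⟩ := hcol
    have hNE : (M ＼ {e}).E = M.E \ {e} := Matroid.delete_ground M {e}
    have hn1 : 1 ≤ n := by
      rw [← hn]
      exact (Set.ncard_pos M.ground_finite).2 ⟨e, heE⟩
    have hNn : (M ＼ {e}).E.ncard = n - 1 := by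
      rw [hNE, Set.ncard_sdiff_singleton_of_mem heE, hn]
    have hNL : ∀ x ∈ (M ＼ {e}).E, ¬ (M ＼ {e}).IsLoop x := fun x hx hl =>
      hL x (by rw [hNE] at hx; exact hx.1) (Matroid.delete_isLoop_iff.1 hl).1
    obtain ⟨B₁, hB₁⟩ := (M ＼ {e}).exists_isBase
    have hB₁M : M.IsBase B₁ ∧ e ∉ B₁ := (isBase_delete_singleton_iff M he).1 hB₁
    have ih' := ih (n - 1) (by omega) (M ＼ {e}) hNn hNL B₁ hB₁
    have hset : {B : Set α | (M ＼ {e}).IsBase B} = {B : Set α | M.IsBase B ∧ e ∉ B} := by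
      ext B
      exact isBase_delete_singleton_iff M he
    rw [hset, hNn] at ih'
    have hne : M.IsNonloop e := Matroid.isNonloop_of_not_isLoop heE (hL e heE)
    obtain ⟨B₂, hB₂, heB₂⟩ := hne.exists_mem_isBase
    have hsplit : {B : Set α | M.IsBase B} =
        {B : Set α | M.IsBase B ∧ e ∉ B} ∪ {B : Set α | M.IsBase B ∧ e ∈ B} := by
      ext B
      simp only [Set.mem_setOf_eq, Set.mem_union]
      constructor
      · intro hB
        by_cases heB : e ∈ B
        · exact Or.inr ⟨hB, heB⟩
        · exact Or.inl ⟨hB, heB⟩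
      · rintro (h | h) <;> exact h.1
    have hdisj : Disjoint {B : Set α | M.IsBase B ∧ e ∉ B} {B : Set α | M.IsBase B ∧ e ∈ B} := by
      rw [Set.disjoint_left]
      rintro B ⟨-, h1⟩ ⟨-, h2⟩
      exact h1 h2
    have hcard : {B : Set α | M.IsBase B}.ncard =
        {B : Set α | M.IsBase B ∧ e ∉ B}.ncard + {B : Set α | M.IsBase B ∧ e ∈ B}.ncard := by
      rw [hsplit]
      exact Set.ncard_union_eq hdisj (hfin.subset (fun B hB => hB.1)) (hfin.subset (fun B hB => hB.1))
    have hpos : 1 ≤ {B : Set α | M.IsBase B ∧ e ∈ B}.ncard :=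
      (Set.ncard_pos (hfin.subset (fun B hB => hB.1))).2 ⟨B₂, hB₂, heB₂⟩
    have hB01 : B₀.ncard = B₁.ncard := hB₀.ncard_eq_ncard_of_isBase hB₁M.1
    omega
  · push Not at hcol
    have hEB : M.E ⊆ B₀ := fun x hx => (hcol x hx).mem_of_isBase hB₀
    have hB₀E : B₀ = M.E := Set.Subset.antisymm hB₀.subset_ground hEB
    have hpos : 1 ≤ {B : Set α | M.IsBase B}.ncard := (Set.ncard_pos hfin).2 ⟨B₀, hB₀⟩
    rw [hB₀E]
    omega

end S2

end PercRepro
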